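import Literature.Computability.MetaComplexity.EFAssemblySem
import HarnessLib

/-!
# Assembly of the RSA-pair tautologies, IV: the refutation's occurrences

The extension side `E` of the `EF`-refutation of `T₀ ∧ T₁` (`EFAssemblySem.lean`): chain
occurrences `B₀ = CH(res A₁, u₀)`, `A₄ = CH(res B₀, u₁)`, `A₂ = CH(res Z₁, u₀)`,
`C₀ = CH(res Y₁, u₀)`, the families `Hs_j, Ht_j, Hp_j = CH(node of Z₁, u₀)` of the
exponent-swap law (`EFChainLaws.lean`), the domain / unit supports of the chains involved
(`EFChainLaws.lean`, `EFChainLaws.lean`) and the data of the `2W` distributivity instances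
(`EFChainLaws.lean`): operation occurrences `Q, R, QQ, PP, PR` and medial / unit auxiliaries.
All are free occurrences (base + input map) allocated consecutively above `Eb` in families
with closed-form bases; this file defines them, the list `RSA.E` of their definitions, and
proves the wiring shapes (`RSA.swapShape`, `RSA.distShapeS`, `RSA.distShapeP`).

## Sources

* J. Krajíček, P. Pudlák, *Some consequences of cryptographical conjectures for `S¹₂` and `EF`*,
  Inform. and Comput. 140 (1998), Thm. 1, Cor. 10.
* S. A. Cook, R. A. Reckhow, *The relative efficiency of propositional proof systems*,
  J. Symbolic Logic 44 (1979), Def. 4.1.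
-/

namespace Literature.Computability.MetaComplexity

open _root_.Computability Complexity Complexity.PropForm FregeSystem Netlist ModAdd

namespace RSA

variable {W : ℕ} (k : ModAdd.OpKit W) (m P₀ P₁ Eb : ℕ)

/-! ### Lengths and anchors -/

/-- Size of a domain-support cell: two domain auxiliaries and a comparator. [folklore] -/
def c1 : ℕ := 2 * k.domA.T.length + (3 * W + 1)
/-- Size of a unit-support cell: two unit auxiliaries. [folklore] -/
def c5 : ℕ := 2 * k.unitA.T.length
/-- Size of an auxiliary cell of a distributivity instance: two medial and one unit auxiliary. [folklore] -/
def c6 : ℕ := 2 * k.medA.T.length + k.unitA.T.length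

/-- The modulus word of copy `1`. [folklore] -/
abbrev nw1 : ℕ → ℕ := nw m P₁
/-- `A₁ = CH(res Y₁, e)` of copy `1`. [folklore] -/
abbrev A1 : Occ := Ao k m P₁
/-- `Z₁ = CH(res A₁, u₁)` of copy `1` (the chain `A₁` of the swap law). [folklore] -/
abbrev Z1 : Occ := Zo k m P₁

/-! ### Domain-support cells -/

/-- The domain auxiliary of `S_{j'}` of the chain occurrence `o`, in the cell at `b`. [folklore] -/
def domS (b : ℕ) (o : Occ) (j' : ℕ) : Occ := ⟨b + j' * c1 k, fun q => (k.domA.src q).val fun _ => k.So o j'⟩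
/-- The domain auxiliary of `P_{j'}`. [folklore] -/
def domP (b : ℕ) (o : Occ) (j' : ℕ) : Occ := ⟨b + j' * c1 k + k.domA.T.length, fun q => (k.domA.src q).val fun _ => k.Po o j'⟩
/-- The comparator of `t_{j'}` with `n`. [folklore] -/
def domD (b : ℕ) (o : Occ) (j' : ℕ) : Occ := ⟨b + j' * c1 k + 2 * k.domA.T.length, inp2 (W := W) (k.t o j') fun i => o.inp (2 * W + i)⟩
/-- Its view. [folklore] -/
def Dview (b : ℕ) (o : Occ) (j' : ℕ) : Sub.View := ⟨b + j' * c1 k + 2 * k.domA.T.length, k.t o j', fun i => o.inp (2 * W + i)⟩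

/-! ### Family 1: the domain support of `A₁`; family 2: the four chains -/

/-- End of family 1. [folklore] -/
def F1e : ℕ := Eb + (W + 1) * c1 k
/-- `B₀ = CH(res A₁, u₀)` (= `A₃` of the swap law). [folklore] -/
def B0 : Occ := ⟨F1e k Eb, inp3 (W := W) (k.t (A1 k m P₁) W) (uw m P₀) (nw1 m P₁)⟩
/-- `A₄ = CH(res B₀, u₁)`. [folklore] -/
def A4o : Occ := ⟨F1e k Eb + k.chainT.length, inp3 (W := W) (k.t (B0 k m P₀ P₁ Eb) W) (uw m P₁) (nw1 m P₁)⟩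
/-- `A₂ = CH(res Z₁, u₀)`. [folklore] -/
def A2o : Occ := ⟨F1e k Eb + 2 * k.chainT.length, inp3 (W := W) (k.t (Z1 k m P₁) W) (uw m P₀) (nw1 m P₁)⟩
/-- `C₀ = CH(res Y₁, u₀)`. [folklore] -/
def Cc0 : Occ := ⟨F1e k Eb + 3 * k.chainT.length, inp3 (W := W) (k.res (Yo (W := W) m P₁)) (uw m P₀) (nw1 m P₁)⟩
/-- End of family 2. [folklore] -/
def F2e : ℕ := F1e k Eb + 4 * k.chainT.length

/-! ### Family 3: the chains `Hs_j, Ht_j, Hp_j` -/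

/-- `Hs_j = CH(s¹_j, u₀)`. [folklore] -/
def Hs (j : ℕ) : Occ := ⟨F2e k Eb + j * k.chainT.length, inp3 (W := W) (k.s (Z1 k m P₁) j) (uw m P₀) (nw1 m P₁)⟩
/-- `Ht_j = CH(t¹_j, u₀)`. [folklore] -/
def Ht (j : ℕ) : Occ := ⟨F2e k Eb + (W + 1 + j) * k.chainT.length, inp3 (W := W) (k.t (Z1 k m P₁) j) (uw m P₀) (nw1 m P₁)⟩
/-- `Hp_j = CH(p¹_j, u₀)`. [folklore] -/
def Hp (j : ℕ) : Occ := ⟨F2e k Eb + (2 * W + 2 + j) * k.chainT.length, inp3 (W := W) (k.p (Z1 k m P₁) j) (uw m P₀) (nw1 m P₁)⟩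
/-- End of family 3. [folklore] -/
def F3e : ℕ := F2e k Eb + (3 * W + 3) * k.chainT.length

/-! ### Family 4: domain supports of `Z₁, Hs_j, Ht_j`; family 5: unit support of `Ht_0` -/

/-- The supported chains: `Z₁` (`c = 0`), `Hs_{c-1}` (`1 ≤ c ≤ W+1`), `Ht_{c-W-2}` (`c ≥ W+2`). [folklore] -/
def chn (c : ℕ) : Occ := if c = 0 then Z1 k m P₁ else if c ≤ W + 1 then Hs k m P₀ P₁ Eb (c - 1) else Ht k m P₀ P₁ Eb (c - W - 2)
/-- Base of the support cells of chain `c`. [folklore] -/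
def F4b (c : ℕ) : ℕ := F3e k Eb + c * (W + 1) * c1 k
/-- End of family 4. [folklore] -/
def F4e : ℕ := F3e k Eb + (2 * W + 3) * (W + 1) * c1 k
/-- Unit auxiliary of `S_{j'}` of `Ht_0`. [folklore] -/
def uS (j' : ℕ) : Occ := ⟨F4e k Eb + j' * c5 k, fun q => (k.unitA.src q).val fun _ => k.So (Ht k m P₀ P₁ Eb 0) j'⟩
/-- Unit auxiliary of `P_{j'}` of `Ht_0`. [folklore] -/
def uP (j' : ℕ) : Occ := ⟨F4e k Eb + j' * c5 k + k.unitA.T.length, fun q => (k.unitA.src q).val fun _ => k.Po (Ht k m P₀ P₁ Eb 0) j'⟩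
/-- End of family 5. [folklore] -/
def F5e : ℕ := F4e k Eb + (W + 1) * c5 k

/-! ### Families 6–7: the distributivity instances -/

/-- Index of the cell `(j, j')`. [folklore] -/
def ci (j j' : ℕ) : ℕ := j * (W + 1) + j'

section DistData

variable (b : ℕ) (B C : ℕ → Occ)

/-- `Q_{j'} = s^B_{j'} ∘ s^C_{j'}` of instance `j`, family at `b`. [folklore] -/
def Qo (j j' : ℕ) : Occ := ⟨b + ci (W := W) j j' * (2 * k.T.length), inp3 (W := W) (k.s (B j) j') (k.s (C j) j') (nw1 m P₁)⟩
/-- `R_{j'} = t^B_{j'} ∘ t^C_{j'}`. [folklore] -/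
def Ro (j j' : ℕ) : Occ := ⟨b + ci (W := W) j j' * (2 * k.T.length) + k.T.length, inp3 (W := W) (k.t (B j) j') (k.t (C j) j') (nw1 m P₁)⟩
/-- End of the `Q, R` family. [folklore] -/
def Fae : ℕ := b + (W + 1) * (W + 1) * (2 * k.T.length)
/-- `QQ_{j'} = Q_{j'} ∘ Q_{j'}`. [folklore] -/
def QQo (j j' : ℕ) : Occ :=
  ⟨Fae k b + ci (W := W) j j' * (3 * k.T.length), inp3 (W := W) (k.res (Qo k m P₁ b B C j j')) (k.res (Qo k m P₁ b B C j j')) (nw1 m P₁)⟩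
/-- `PP_{j'} = R_{j'} ∘ Q_{j'}`. [folklore] -/
def PPo (j j' : ℕ) : Occ :=
  ⟨Fae k b + ci (W := W) j j' * (3 * k.T.length) + k.T.length, inp3 (W := W) (k.res (Ro k m P₁ b B C j j')) (k.res (Qo k m P₁ b B C j j')) (nw1 m P₁)⟩
/-- `PR_{j'} = p^B_{j'} ∘ p^C_{j'}`. [folklore] -/
def PRo (j j' : ℕ) : Occ :=
  ⟨Fae k b + ci (W := W) j j' * (3 * k.T.length) + 2 * k.T.length, inp3 (W := W) (k.p (B j) j') (k.p (C j) j') (nw1 m P₁)⟩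
/-- End of the `QQ, PP, PR` family. [folklore] -/
def Fbe : ℕ := Fae k b + (W + 1) * (W + 1) * (3 * k.T.length)
/-- The first medial auxiliary of step `j'` of instance `j`. [folklore] -/
def M1o (j j' : ℕ) : Occ :=
  ⟨Fbe k b + ci (W := W) j j' * c6 k, fun q => (k.medA.src q).val (k.os1 (B j) (C j) (Qo k m P₁ b B C j) (QQo k m P₁ b B C j) j')⟩
/-- The second medial auxiliary. [folklore] -/
def M2o (j j' : ℕ) : Occ :=
  ⟨Fbe k b + ci (W := W) j j' * c6 k + k.medA.T.length, fun q =>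
    (k.medA.src q).val (k.os2 (B j) (C j) (Qo k m P₁ b B C j) (Ro k m P₁ b B C j) (PPo k m P₁ b B C j) (PRo k m P₁ b B C j) j')⟩
/-- The unit auxiliary of `R_{j'}` (used for `j' = 0`). [folklore] -/
def Uo (j j' : ℕ) : Occ :=
  ⟨Fbe k b + ci (W := W) j j' * c6 k + 2 * k.medA.T.length, fun q => (k.unitA.src q).val fun _ => Ro k m P₁ b B C j j'⟩
/-- End of the auxiliary family (and of the instance data). [folklore] -/
def Fce : ℕ := Fbe k b + (W + 1) * (W + 1) * c6 k

end DistData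

/-- Base of the `S`-instances' data. [folklore] -/
def F6b : ℕ := F5e k Eb
/-- Base of the `P`-instances' data. [folklore] -/
def F7b : ℕ := Fce k (F6b k Eb)
/-- End of `E`. [folklore] -/
def Eend : ℕ := Fce k (F7b k Eb)

/-- The `B`-chains of the `S`-instances: `Hs_j`; of the `P`-instances: `Ht_j`. The `C`-chains: `Hs_j`. [folklore] -/
abbrev HsF : ℕ → Occ := Hs k m P₀ P₁ Eb
/-- See `HsF`. [folklore] -/
abbrev HtF : ℕ → Occ := Ht k m P₀ P₁ Eb

/-! ### The extension list -/

/-- The definitions of a domain-support cell. [folklore] -/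
def domCell (b : ℕ) (o : Occ) (j' : ℕ) : List (ℕ × PropForm ℕ) :=
  (domS k b o j').edefs k.domA.T k.domA.nIn ++ (domP k b o j').edefs k.domA.T k.domA.nIn ++ (domD k b o j').edefs (Sub.subT W) (2 * W)

/-- The definitions of the data of a family of distributivity instances at `b`. [folklore] -/
def distDefs (b : ℕ) (B C : ℕ → Occ) : List (ℕ × PropForm ℕ) :=
  (List.range ((W + 1) * (W + 1))).flatMap (fun c => (Qo k m P₁ b B C (c / (W + 1)) (c % (W + 1))).edefs k.T (3 * W) ++
      (Ro k m P₁ b B C (c / (W + 1)) (c % (W + 1))).edefs k.T (3 * W)) ++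
  (List.range ((W + 1) * (W + 1))).flatMap (fun c => (QQo k m P₁ b B C (c / (W + 1)) (c % (W + 1))).edefs k.T (3 * W) ++
      (PPo k m P₁ b B C (c / (W + 1)) (c % (W + 1))).edefs k.T (3 * W) ++ (PRo k m P₁ b B C (c / (W + 1)) (c % (W + 1))).edefs k.T (3 * W)) ++
  (List.range ((W + 1) * (W + 1))).flatMap (fun c => (M1o k m P₁ b B C (c / (W + 1)) (c % (W + 1))).edefs k.medA.T k.medA.nIn ++
      (M2o k m P₁ b B C (c / (W + 1)) (c % (W + 1))).edefs k.medA.T k.medA.nIn ++ (Uo k m P₁ b B C (c / (W + 1)) (c % (W + 1))).edefs k.unitA.T k.unitA.nIn)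

/-- **The extension list of the refutation.** [cite: CookReckhow1979, Def. 4.1] -/
def E : List (ℕ × PropForm ℕ) :=
  (List.range (W + 1)).flatMap (domCell k Eb (A1 k m P₁)) ++
  ((B0 k m P₀ P₁ Eb).edefs k.chainT (3 * W) ++ (A4o k m P₀ P₁ Eb).edefs k.chainT (3 * W) ++ (A2o k m P₀ P₁ Eb).edefs k.chainT (3 * W) ++
    (Cc0 k m P₀ P₁ Eb).edefs k.chainT (3 * W)) ++
  ((List.range (W + 1)).flatMap (fun j => (Hs k m P₀ P₁ Eb j).edefs k.chainT (3 * W)) ++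
    (List.range (W + 1)).flatMap (fun j => (Ht k m P₀ P₁ Eb j).edefs k.chainT (3 * W)) ++
    (List.range (W + 1)).flatMap (fun j => (Hp k m P₀ P₁ Eb j).edefs k.chainT (3 * W))) ++
  (List.range (2 * W + 3)).flatMap (fun c => (List.range (W + 1)).flatMap (domCell k (F4b k Eb c) (chn k m P₀ P₁ Eb c))) ++
  (List.range (W + 1)).flatMap (fun j' => (uS k m P₀ P₁ Eb j').edefs k.unitA.T k.unitA.nIn ++ (uP k m P₀ P₁ Eb j').edefs k.unitA.T k.unitA.nIn) ++
  distDefs k m P₁ (F6b k Eb) (HsF k m P₀ P₁ Eb) (HsF k m P₀ P₁ Eb) ++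
  distDefs k m P₁ (F7b k Eb) (HtF k m P₀ P₁ Eb) (HsF k m P₀ P₁ Eb)

/-! ### The shapes -/

variable {k m P₀ P₁ Eb}

/-- **The swap shape.** [folklore] -/
theorem swapShape : k.SwapShape (Z1 k m P₁) (A2o k m P₀ P₁ Eb) (B0 k m P₀ P₁ Eb) (A4o k m P₀ P₁ Eb) (Hs k m P₀ P₁ Eb) (Ht k m P₀ P₁ Eb) (Hp k m P₀ P₁ Eb) where
  hA2x i hi := by simp [A2o, inp3, hi]
  hA2y i hi := by simp only [A2o, B0]; rw [inp3_y _ _ _ _ hi, inp3_y _ _ _ _ hi]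
  hA2n i hi := by simp only [A2o, Z1, Zo]; rw [inp3_n, inp3_n]
  hA3x i hi := by simp [B0, Z1, Zo, inp3, hi]
  hA3n i hi := by simp only [B0, Z1, Zo]; rw [inp3_n, inp3_n]
  hA4x i hi := by simp [A4o, inp3, hi]
  hA4y j hj := by simp only [A4o, Z1, Zo]; rw [inp3_y _ _ _ _ hj, inp3_y _ _ _ _ hj]
  hA4n i hi := by simp only [A4o, Z1, Zo]; rw [inp3_n, inp3_n]
  hHsx j _ i hi := by simp [Hs, inp3, hi]
  hHsy j _ i hi := by simp only [Hs, B0]; rw [inp3_y _ _ _ _ hi, inp3_y _ _ _ _ hi]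
  hHsn j _ i hi := by simp only [Hs, Z1, Zo]; rw [inp3_n, inp3_n]
  hHtx j _ i hi := by simp [Ht, inp3, hi]
  hHty j _ i hi := by simp only [Ht, B0]; rw [inp3_y _ _ _ _ hi, inp3_y _ _ _ _ hi]
  hHtn j _ i hi := by simp only [Ht, Z1, Zo]; rw [inp3_n, inp3_n]
  hHpx j _ i hi := by simp [Hp, inp3, hi]
  hHpy j _ i hi := by simp only [Hp, B0]; rw [inp3_y _ _ _ _ hi, inp3_y _ _ _ _ hi]
  hHpn j _ i hi := by simp only [Hp, Z1, Zo]; rw [inp3_n, inp3_n]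

/-- **The shape of an `S`-instance** (`O = S_j(Z₁)`, `A = Hs_{j+1}`, `B = C = Hs_j`) or of a
`P`-instance (`O = P_j(Z₁)`, `A = Hp_j`, `B = Ht_j`, `C = Hs_j`), for a family at `b` whose
`B`, `C` chains read `u₀` and `n`. [folklore] -/
theorem distShape {b : ℕ} {B C : ℕ → Occ} {O A : Occ} {j : ℕ} (hAa : ∀ i < W, A.inp i = k.res O i) (hBa : ∀ i < W, (B j).inp i = O.inp i)
    (hCa : ∀ i < W, (C j).inp i = O.inp (W + i)) (hAy : ∀ i < W, A.inp (W + i) = uw m P₀ i) (hBy : ∀ i < W, (B j).inp (W + i) = uw m P₀ i)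
    (hCy : ∀ i < W, (C j).inp (W + i) = uw m P₀ i) (hOn : ∀ i < W, O.inp (2 * W + i) = nw1 m P₁ i) (hAn : ∀ i < W, A.inp (2 * W + i) = nw1 m P₁ i)
    (hBn : ∀ i < W, (B j).inp (2 * W + i) = nw1 m P₁ i) (hCn : ∀ i < W, (C j).inp (2 * W + i) = nw1 m P₁ i) :
    k.DistShape O A (B j) (C j) (Qo k m P₁ b B C j) (Ro k m P₁ b B C j) (QQo k m P₁ b B C j) (PPo k m P₁ b B C j) (PRo k m P₁ b B C j) where
  hAa := hAa
  hBa := hBa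
  hCa := hCa
  hAb j' hj' := by rw [hAy j' hj', hBy j' hj']
  hCb j' hj' := by rw [hCy j' hj', hBy j' hj']
  hAn i hi := by rw [hAn i hi, hOn i hi]
  hBn i hi := by rw [hBn i hi, hOn i hi]
  hCn i hi := by rw [hCn i hi, hOn i hi]
  hQx j' _ i hi := by simp [Qo, inp3, hi]
  hQy j' _ i hi := by simp only [Qo]; rw [inp3_y _ _ _ _ hi]
  hQn j' _ i hi := by simp only [Qo]; rw [inp3_n, hOn i hi]
  hRx j' _ i hi := by simp [Ro, inp3, hi]
  hRy j' _ i hi := by simp only [Ro]; rw [inp3_y _ _ _ _ hi]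
  hRn j' _ i hi := by simp only [Ro]; rw [inp3_n, hOn i hi]
  hQQx j' _ i hi := by simp [QQo, inp3, hi]
  hQQy j' _ i hi := by simp only [QQo]; rw [inp3_y _ _ _ _ hi]
  hQQn j' _ i hi := by simp only [QQo]; rw [inp3_n, hOn i hi]
  hPPx j' _ i hi := by simp [PPo, inp3, hi]
  hPPy j' _ i hi := by simp only [PPo]; rw [inp3_y _ _ _ _ hi]
  hPPn j' _ i hi := by simp only [PPo]; rw [inp3_n, hOn i hi]
  hPRx j' _ i hi := by simp [PRo, inp3, hi]
  hPRy j' _ i hi := by simp only [PRo]; rw [inp3_y _ _ _ _ hi]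
  hPRn j' _ i hi := by simp only [PRo]; rw [inp3_n, hOn i hi]

/-- The shape of the `S`-instance `j`. [folklore] -/
theorem distShapeS (j : ℕ) :
    k.DistShape (k.So (Z1 k m P₁) j) (Hs k m P₀ P₁ Eb (j + 1)) (Hs k m P₀ P₁ Eb j) (Hs k m P₀ P₁ Eb j) (Qo k m P₁ (F6b k Eb) (HsF k m P₀ P₁ Eb) (HsF k m P₀ P₁ Eb) j)
      (Ro k m P₁ (F6b k Eb) (HsF k m P₀ P₁ Eb) (HsF k m P₀ P₁ Eb) j) (QQo k m P₁ (F6b k Eb) (HsF k m P₀ P₁ Eb) (HsF k m P₀ P₁ Eb) j)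
      (PPo k m P₁ (F6b k Eb) (HsF k m P₀ P₁ Eb) (HsF k m P₀ P₁ Eb) j) (PRo k m P₁ (F6b k Eb) (HsF k m P₀ P₁ Eb) (HsF k m P₀ P₁ Eb) j) := by
  refine distShape (P₀ := P₀) (fun i hi => ?_) (fun i hi => ?_) (fun i hi => ?_) (fun i hi => ?_) (fun i hi => ?_) (fun i hi => ?_) (fun i hi => ?_)
    (fun i hi => ?_) (fun i hi => ?_) (fun i hi => ?_)
  · simp [Hs, inp3, hi, OpKit.res_So]
  · simp only [Hs]; rw [inp3_x hi, OpKit.So_x hi]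
  · simp only [Hs]; rw [inp3_x hi, OpKit.So_y hi]
  · simp only [Hs]; rw [inp3_y _ _ _ _ hi]
  · simp only [Hs]; rw [inp3_y _ _ _ _ hi]
  · simp only [Hs]; rw [inp3_y _ _ _ _ hi]
  · rw [OpKit.So_n]; simp only [Z1, Zo]; rw [inp3_n]
  · simp only [Hs]; rw [inp3_n]
  · simp only [Hs]; rw [inp3_n]
  · simp only [Hs]; rw [inp3_n]

/-- The shape of the `P`-instance `j`. [folklore] -/
theorem distShapeP (j : ℕ) :
    k.DistShape (k.Po (Z1 k m P₁) j) (Hp k m P₀ P₁ Eb j) (Ht k m P₀ P₁ Eb j) (Hs k m P₀ P₁ Eb j) (Qo k m P₁ (F7b k Eb) (HtF k m P₀ P₁ Eb) (HsF k m P₀ P₁ Eb) j)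
      (Ro k m P₁ (F7b k Eb) (HtF k m P₀ P₁ Eb) (HsF k m P₀ P₁ Eb) j) (QQo k m P₁ (F7b k Eb) (HtF k m P₀ P₁ Eb) (HsF k m P₀ P₁ Eb) j)
      (PPo k m P₁ (F7b k Eb) (HtF k m P₀ P₁ Eb) (HsF k m P₀ P₁ Eb) j) (PRo k m P₁ (F7b k Eb) (HtF k m P₀ P₁ Eb) (HsF k m P₀ P₁ Eb) j) := by
  refine distShape (P₀ := P₀) (fun i hi => ?_) (fun i hi => ?_) (fun i hi => ?_) (fun i hi => ?_) (fun i hi => ?_) (fun i hi => ?_) (fun i hi => ?_)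
    (fun i hi => ?_) (fun i hi => ?_) (fun i hi => ?_)
  · simp [Hp, inp3, hi, OpKit.p]
  · simp only [Ht]; rw [inp3_x hi, OpKit.Po_x hi]
  · simp only [Hs]; rw [inp3_x hi, OpKit.Po_y hi]
  · simp only [Hp]; rw [inp3_y _ _ _ _ hi]
  · simp only [Ht]; rw [inp3_y _ _ _ _ hi]
  · simp only [Hs]; rw [inp3_y _ _ _ _ hi]
  · rw [OpKit.Po_n]; simp only [Z1, Zo]; rw [inp3_n]
  · simp only [Hp]; rw [inp3_n]
  · simp only [Ht]; rw [inp3_n]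
  · simp only [Hs]; rw [inp3_n]

/-! ### Availability of the occurrences -/

section Avail

variable {K : PropForm ℕ} {Γ : Set (PropForm ℕ)}

/-- The view of a comparator occurrence. [folklore] -/
theorem subView_avail {o : Occ} (ho : o.Avail (Sub.subT W) (2 * W) K Γ) {x y : ℕ → ℕ} (hx : ∀ i < W, o.inp i = x i) (hy : ∀ i < W, o.inp (W + i) = y i) :
    (⟨o.base, x, y⟩ : Sub.View).Avail K Γ W := by
  have h : (o.inst (2 * W)).DefsAvail (Sub.subT W) K Γ := ho
  refine (Sub.avail_viewOf h).congr rfl (fun i hi => ?_) fun i hi => ?_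
  · show x i = (o.inst (2 * W)).inputs.getD i 0; rw [o.getD_inst (by omega), hx i hi]
  · show y i = (o.inst (2 * W)).inputs.getD (W + i) 0; rw [o.getD_inst (by omega), hy i hi]

/-- **A domain-support cell family gives domain support.** [folklore] -/
theorem domSupport_of {b : ℕ} {o : Occ} (h : ∀ j' ≤ W, ∀ e ∈ domCell k b o j', ctx K (biimp (var e.1) e.2) ∈ Γ) :
    k.DomSupport o (Dview k b o) K Γ where
  dS j hj := ⟨domS k b o j, Occ.avail_of_forall_mem fun e he => h j hj.le e (by simp [domCell, he]), fun _ _ => rfl⟩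
  dP j hj := ⟨domP k b o j, Occ.avail_of_forall_mem fun e he => h j hj.le e (by simp [domCell, he]), fun _ _ => rfl⟩
  hD j hj := subView_avail (o := domD k b o j) (Occ.avail_of_forall_mem fun e he => h j hj e (by simp [domCell, he])) (fun i hi => by simp [domD, inp2, hi])
    fun i hi => by simp only [domD]; unfold inp2; rw [if_neg (by omega), Nat.add_sub_cancel_left]
  hDx j _ i _ := rfl
  hDy j _ i _ := rfl

variable (hE : ∀ e ∈ E k m P₀ P₁ Eb, ctx K (biimp (var e.1) e.2) ∈ Γ)
include hE

/-- Group membership in `E`. [folklore] -/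
theorem memE {e : ℕ × PropForm ℕ}
    (h : e ∈ (List.range (W + 1)).flatMap (domCell k Eb (A1 k m P₁)) ∨
      e ∈ (B0 k m P₀ P₁ Eb).edefs k.chainT (3 * W) ++ (A4o k m P₀ P₁ Eb).edefs k.chainT (3 * W) ++ (A2o k m P₀ P₁ Eb).edefs k.chainT (3 * W) ++
        (Cc0 k m P₀ P₁ Eb).edefs k.chainT (3 * W) ∨
      e ∈ (List.range (W + 1)).flatMap (fun j => (Hs k m P₀ P₁ Eb j).edefs k.chainT (3 * W)) ++
        (List.range (W + 1)).flatMap (fun j => (Ht k m P₀ P₁ Eb j).edefs k.chainT (3 * W)) ++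
        (List.range (W + 1)).flatMap (fun j => (Hp k m P₀ P₁ Eb j).edefs k.chainT (3 * W)) ∨
      e ∈ (List.range (2 * W + 3)).flatMap (fun c => (List.range (W + 1)).flatMap (domCell k (F4b k Eb c) (chn k m P₀ P₁ Eb c))) ∨
      e ∈ (List.range (W + 1)).flatMap (fun j' => (uS k m P₀ P₁ Eb j').edefs k.unitA.T k.unitA.nIn ++ (uP k m P₀ P₁ Eb j').edefs k.unitA.T k.unitA.nIn) ∨
      e ∈ distDefs k m P₁ (F6b k Eb) (HsF k m P₀ P₁ Eb) (HsF k m P₀ P₁ Eb) ∨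
      e ∈ distDefs k m P₁ (F7b k Eb) (HtF k m P₀ P₁ Eb) (HsF k m P₀ P₁ Eb)) : ctx K (biimp (var e.1) e.2) ∈ Γ := by
  apply hE
  unfold E
  rcases h with h | h | h | h | h | h | h
  · exact List.mem_append_left _ (List.mem_append_left _ (List.mem_append_left _ (List.mem_append_left _ (List.mem_append_left _ (List.mem_append_left _ h)))))
  · exact List.mem_append_left _ (List.mem_append_left _ (List.mem_append_left _ (List.mem_append_left _ (List.mem_append_left _ (List.mem_append_right _ h)))))
  · exact List.mem_append_left _ (List.mem_append_left _ (List.mem_append_left _ (List.mem_append_left _ (List.mem_append_right _ h))))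
  · exact List.mem_append_left _ (List.mem_append_left _ (List.mem_append_left _ (List.mem_append_right _ h)))
  · exact List.mem_append_left _ (List.mem_append_left _ (List.mem_append_right _ h))
  · exact List.mem_append_left _ (List.mem_append_right _ h)
  · exact List.mem_append_right _ h

/-- Domain support of `A₁`. [folklore] -/
theorem dsA1 : k.DomSupport (A1 k m P₁) (Dview k Eb (A1 k m P₁)) K Γ :=
  domSupport_of fun j' hj' e he => memE hE (Or.inl (List.mem_flatMap.2 ⟨j', List.mem_range.2 (by omega), he⟩))

/-- `B₀`. [folklore] -/
theorem avB0 : (B0 k m P₀ P₁ Eb).Avail k.chainT (3 * W) K Γ := Occ.avail_of_forall_mem fun e he => memE hE (Or.inr (Or.inl (by simp [he])))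
/-- `A₄`. [folklore] -/
theorem avA4 : (A4o k m P₀ P₁ Eb).Avail k.chainT (3 * W) K Γ := Occ.avail_of_forall_mem fun e he => memE hE (Or.inr (Or.inl (by simp [he])))
/-- `A₂`. [folklore] -/
theorem avA2 : (A2o k m P₀ P₁ Eb).Avail k.chainT (3 * W) K Γ := Occ.avail_of_forall_mem fun e he => memE hE (Or.inr (Or.inl (by simp [he])))
/-- `C₀`. [folklore] -/
theorem avC0 : (Cc0 k m P₀ P₁ Eb).Avail k.chainT (3 * W) K Γ := Occ.avail_of_forall_mem fun e he => memE hE (Or.inr (Or.inl (by simp [he])))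
/-- `Hs_j`. [folklore] -/
theorem avHs {j : ℕ} (hj : j ≤ W) : (Hs k m P₀ P₁ Eb j).Avail k.chainT (3 * W) K Γ :=
  Occ.avail_of_forall_mem fun e he => memE hE (Or.inr (Or.inr (Or.inl (List.mem_append_left _ (List.mem_append_left _
    (List.mem_flatMap.2 ⟨j, List.mem_range.2 (by omega), he⟩))))))
/-- `Ht_j`. [folklore] -/
theorem avHt {j : ℕ} (hj : j ≤ W) : (Ht k m P₀ P₁ Eb j).Avail k.chainT (3 * W) K Γ :=
  Occ.avail_of_forall_mem fun e he => memE hE (Or.inr (Or.inr (Or.inl (List.mem_append_left _ (List.mem_append_right _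
    (List.mem_flatMap.2 ⟨j, List.mem_range.2 (by omega), he⟩))))))
/-- `Hp_j`. [folklore] -/
theorem avHp {j : ℕ} (hj : j ≤ W) : (Hp k m P₀ P₁ Eb j).Avail k.chainT (3 * W) K Γ :=
  Occ.avail_of_forall_mem fun e he => memE hE (Or.inr (Or.inr (Or.inl (List.mem_append_right _
    (List.mem_flatMap.2 ⟨j, List.mem_range.2 (by omega), he⟩)))))
/-- Domain support of the chain `c`. [folklore] -/
theorem dsChn {c : ℕ} (hc : c < 2 * W + 3) : k.DomSupport (chn k m P₀ P₁ Eb c) (Dview k (F4b k Eb c) (chn k m P₀ P₁ Eb c)) K Γ :=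
  domSupport_of fun j' hj' e he => memE hE (Or.inr (Or.inr (Or.inr (Or.inl (List.mem_flatMap.2 ⟨c, List.mem_range.2 hc,
    List.mem_flatMap.2 ⟨j', List.mem_range.2 (by omega), he⟩⟩)))))
/-- Domain support of `Z₁`. [folklore] -/
theorem dsZ1 : k.DomSupport (Z1 k m P₁) (Dview k (F4b k Eb 0) (Z1 k m P₁)) K Γ := by
  have h := dsChn hE (c := 0) (by omega); rwa [show chn k m P₀ P₁ Eb 0 = Z1 k m P₁ from rfl] at h
/-- Domain support of `Hs_j`. [folklore] -/
theorem dsHs {j : ℕ} (hj : j ≤ W) : k.DomSupport (Hs k m P₀ P₁ Eb j) (Dview k (F4b k Eb (j + 1)) (Hs k m P₀ P₁ Eb j)) K Γ := by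
  have h := dsChn hE (c := j + 1) (by omega)
  have e : chn k m P₀ P₁ Eb (j + 1) = Hs k m P₀ P₁ Eb j := by unfold chn; rw [if_neg (by omega), if_pos (by omega), Nat.add_sub_cancel]
  rwa [e] at h
/-- Domain support of `Ht_j`. [folklore] -/
theorem dsHt {j : ℕ} (hj : j ≤ W) : k.DomSupport (Ht k m P₀ P₁ Eb j) (Dview k (F4b k Eb (W + 2 + j)) (Ht k m P₀ P₁ Eb j)) K Γ := by
  have h := dsChn hE (c := W + 2 + j) (by omega)
  have e : chn k m P₀ P₁ Eb (W + 2 + j) = Ht k m P₀ P₁ Eb j := by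
    unfold chn; rw [if_neg (by omega), if_neg (by omega), show W + 2 + j - W - 2 = j by omega]
  rwa [e] at h
/-- Unit support of `Ht_0`. [folklore] -/
theorem usHt0 : k.UnitSupport (Ht k m P₀ P₁ Eb 0) K Γ where
  uS j hj := ⟨uS k m P₀ P₁ Eb j, Occ.avail_of_forall_mem fun e he => memE hE (Or.inr (Or.inr (Or.inr (Or.inr (Or.inl
    (List.mem_flatMap.2 ⟨j, List.mem_range.2 (by omega), List.mem_append_left _ he⟩)))))), fun q _ => rfl⟩
  uP j hj := ⟨uP k m P₀ P₁ Eb j, Occ.avail_of_forall_mem fun e he => memE hE (Or.inr (Or.inr (Or.inr (Or.inr (Or.inl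
    (List.mem_flatMap.2 ⟨j, List.mem_range.2 (by omega), List.mem_append_right _ he⟩)))))), fun q _ => rfl⟩

omit hE in
/-- Cell index arithmetic. [folklore] -/
theorem ci_div_mod {j j' : ℕ} (hj : j ≤ W) (hj' : j' ≤ W) : ci (W := W) j j' < (W + 1) * (W + 1) ∧ ci (W := W) j j' / (W + 1) = j ∧ ci (W := W) j j' % (W + 1) = j' := by
  refine ⟨?_, ?_, ?_⟩
  · unfold ci; nlinarith
  · unfold ci; rw [Nat.mul_comm, Nat.mul_add_div (by omega), Nat.div_eq_of_lt (by omega), Nat.add_zero]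
  · unfold ci; rw [Nat.mul_comm, Nat.mul_add_mod, Nat.mod_eq_of_lt (by omega)]

omit hE in
/-- **Availability of the data of a family of distributivity instances.** [folklore] -/
theorem distData_avail {b : ℕ} {B C : ℕ → Occ} (h : ∀ e ∈ distDefs k m P₁ b B C, ctx K (biimp (var e.1) e.2) ∈ Γ) {j j' : ℕ} (hj : j ≤ W) (hj' : j' ≤ W) :
    (Qo k m P₁ b B C j j').Avail k.T (3 * W) K Γ ∧ (Ro k m P₁ b B C j j').Avail k.T (3 * W) K Γ ∧ (QQo k m P₁ b B C j j').Avail k.T (3 * W) K Γ ∧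
      (PPo k m P₁ b B C j j').Avail k.T (3 * W) K Γ ∧ (PRo k m P₁ b B C j j').Avail k.T (3 * W) K Γ ∧
      (M1o k m P₁ b B C j j').Avail k.medA.T k.medA.nIn K Γ ∧ (M2o k m P₁ b B C j j').Avail k.medA.T k.medA.nIn K Γ ∧
      (Uo k m P₁ b B C j j').Avail k.unitA.T k.unitA.nIn K Γ := by
  obtain ⟨hc, hdiv, hmod⟩ := ci_div_mod (W := W) hj hj'
  have key : ∀ {e : ℕ × PropForm ℕ} (g : ℕ) (hg : g < 3),
      (g = 0 → e ∈ (Qo k m P₁ b B C j j').edefs k.T (3 * W) ∨ e ∈ (Ro k m P₁ b B C j j').edefs k.T (3 * W)) →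
      (g = 1 → (e ∈ (QQo k m P₁ b B C j j').edefs k.T (3 * W) ∨ e ∈ (PPo k m P₁ b B C j j').edefs k.T (3 * W)) ∨ e ∈ (PRo k m P₁ b B C j j').edefs k.T (3 * W)) →
      (g = 2 → (e ∈ (M1o k m P₁ b B C j j').edefs k.medA.T k.medA.nIn ∨ e ∈ (M2o k m P₁ b B C j j').edefs k.medA.T k.medA.nIn) ∨
        e ∈ (Uo k m P₁ b B C j j').edefs k.unitA.T k.unitA.nIn) → ctx K (biimp (var e.1) e.2) ∈ Γ := by
    intro e g hg h0 h1 h2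
    apply h
    simp only [distDefs, List.mem_append, List.mem_flatMap, List.mem_range]
    rcases (show g = 0 ∨ g = 1 ∨ g = 2 by omega) with rfl | rfl | rfl
    · exact Or.inl (Or.inl ⟨ci (W := W) j j', hc, by rw [hdiv, hmod]; exact h0 rfl⟩)
    · exact Or.inl (Or.inr ⟨ci (W := W) j j', hc, by rw [hdiv, hmod]; exact h1 rfl⟩)
    · exact Or.inr ⟨ci (W := W) j j', hc, by rw [hdiv, hmod]; exact h2 rfl⟩
  refine ⟨Occ.avail_of_forall_mem fun e he => key 0 (by omega) (fun _ => by simp [he]) (fun h => by cases h) (fun h => by cases h),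
    Occ.avail_of_forall_mem fun e he => key 0 (by omega) (fun _ => by simp [he]) (fun h => by cases h) (fun h => by cases h),
    Occ.avail_of_forall_mem fun e he => key 1 (by omega) (fun h => by cases h) (fun _ => by simp [he]) (fun h => by cases h),
    Occ.avail_of_forall_mem fun e he => key 1 (by omega) (fun h => by cases h) (fun _ => by simp [he]) (fun h => by cases h),
    Occ.avail_of_forall_mem fun e he => key 1 (by omega) (fun h => by cases h) (fun _ => by simp [he]) (fun h => by cases h),
    Occ.avail_of_forall_mem fun e he => key 2 (by omega) (fun h => by cases h) (fun h => by cases h) (fun _ => by simp [he]),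
    Occ.avail_of_forall_mem fun e he => key 2 (by omega) (fun h => by cases h) (fun h => by cases h) (fun _ => by simp [he]),
    Occ.avail_of_forall_mem fun e he => key 2 (by omega) (fun h => by cases h) (fun h => by cases h) (fun _ => by simp [he])⟩

omit hE in
/-- **`DistAvail` of an instance from the availability of its data and chains.** [folklore] -/
theorem distAvail_of {b : ℕ} {B C : ℕ → Occ} {O A : Occ} {j : ℕ} (h : ∀ e ∈ distDefs k m P₁ b B C, ctx K (biimp (var e.1) e.2) ∈ Γ) (hj : j ≤ W)
    (hO : O.Avail k.T (3 * W) K Γ) (hA : A.Avail k.chainT (3 * W) K Γ) (hB : (B j).Avail k.chainT (3 * W) K Γ) (hC : (C j).Avail k.chainT (3 * W) K Γ) :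
    k.DistAvail O A (B j) (C j) (Qo k m P₁ b B C j) (Ro k m P₁ b B C j) (QQo k m P₁ b B C j) (PPo k m P₁ b B C j) (PRo k m P₁ b B C j) K Γ where
  hO := hO
  cvA := k.chainAvail hA
  cvB := k.chainAvail hB
  cvC := k.chainAvail hC
  hQ _ hj' := (distData_avail h hj hj').1
  hR _ hj' := (distData_avail h hj hj').2.1
  hQQ _ hj' := (distData_avail h hj hj'.le).2.2.1
  hPP _ hj' := (distData_avail h hj hj'.le).2.2.2.1
  hPR _ hj' := (distData_avail h hj hj'.le).2.2.2.2.1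
  m1 j' hj' := ⟨M1o k m P₁ b B C j j', (distData_avail h hj hj'.le).2.2.2.2.2.1, fun _ _ => rfl⟩
  m2 j' hj' := ⟨M2o k m P₁ b B C j j', (distData_avail h hj hj'.le).2.2.2.2.2.2.1, fun _ _ => rfl⟩
  uR := ⟨Uo k m P₁ b B C j 0, (distData_avail h hj (Nat.zero_le W)).2.2.2.2.2.2.2, fun _ _ => rfl⟩

/-- `DistAvail` of the `S`-instance `j` (given the availability of `Z₁`). [folklore] -/
theorem distAvailS (cvZ : k.ChainViews (Z1 k m P₁) K Γ) {j : ℕ} (hj : j < W) :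
    k.DistAvail (k.So (Z1 k m P₁) j) (Hs k m P₀ P₁ Eb (j + 1)) (Hs k m P₀ P₁ Eb j) (Hs k m P₀ P₁ Eb j) (Qo k m P₁ (F6b k Eb) (HsF k m P₀ P₁ Eb) (HsF k m P₀ P₁ Eb) j)
      (Ro k m P₁ (F6b k Eb) (HsF k m P₀ P₁ Eb) (HsF k m P₀ P₁ Eb) j) (QQo k m P₁ (F6b k Eb) (HsF k m P₀ P₁ Eb) (HsF k m P₀ P₁ Eb) j)
      (PPo k m P₁ (F6b k Eb) (HsF k m P₀ P₁ Eb) (HsF k m P₀ P₁ Eb) j) (PRo k m P₁ (F6b k Eb) (HsF k m P₀ P₁ Eb) (HsF k m P₀ P₁ Eb) j) K Γ :=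
  distAvail_of (B := HsF k m P₀ P₁ Eb) (C := HsF k m P₀ P₁ Eb) (fun _ he => memE hE (Or.inr (Or.inr (Or.inr (Or.inr (Or.inr (Or.inl he))))))) hj.le
    (cvZ.S j hj) (avHs hE (by omega)) (avHs hE hj.le) (avHs hE hj.le)

/-- `DistAvail` of the `P`-instance `j`. [folklore] -/
theorem distAvailP (cvZ : k.ChainViews (Z1 k m P₁) K Γ) {j : ℕ} (hj : j < W) :
    k.DistAvail (k.Po (Z1 k m P₁) j) (Hp k m P₀ P₁ Eb j) (Ht k m P₀ P₁ Eb j) (Hs k m P₀ P₁ Eb j) (Qo k m P₁ (F7b k Eb) (HtF k m P₀ P₁ Eb) (HsF k m P₀ P₁ Eb) j)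
      (Ro k m P₁ (F7b k Eb) (HtF k m P₀ P₁ Eb) (HsF k m P₀ P₁ Eb) j) (QQo k m P₁ (F7b k Eb) (HtF k m P₀ P₁ Eb) (HsF k m P₀ P₁ Eb) j)
      (PPo k m P₁ (F7b k Eb) (HtF k m P₀ P₁ Eb) (HsF k m P₀ P₁ Eb) j) (PRo k m P₁ (F7b k Eb) (HtF k m P₀ P₁ Eb) (HsF k m P₀ P₁ Eb) j) K Γ :=
  distAvail_of (B := HtF k m P₀ P₁ Eb) (C := HsF k m P₀ P₁ Eb) (fun _ he => memE hE (Or.inr (Or.inr (Or.inr (Or.inr (Or.inr (Or.inr he))))))) hj.le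
    (cvZ.P j hj) (avHp hE hj.le) (avHt hE hj.le) (avHs hE hj.le)

/-- **`SwapAvail`** (given the availability of `Z₁`). [folklore] -/
theorem swapAvail (cvZ : k.ChainViews (Z1 k m P₁) K Γ) :
    k.SwapAvail (Z1 k m P₁) (A2o k m P₀ P₁ Eb) (B0 k m P₀ P₁ Eb) (A4o k m P₀ P₁ Eb) (Hs k m P₀ P₁ Eb) (Ht k m P₀ P₁ Eb) (Hp k m P₀ P₁ Eb) K Γ :=
  ⟨cvZ, avA2 hE, avB0 hE, k.chainAvail (avA4 hE), avHs hE (Nat.zero_le W), fun _ hj => avHt hE hj, fun _ hj => avHp hE hj.le⟩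

end Avail

end RSA

end Literature.Computability.MetaComplexity

/-!
# Assembly of the RSA-pair tautologies, V: the refutation

The `EF`-derivation of `K ∨ ⊥` (`K` the context variable) from the available lines
`K ∨ c` (`c ∈ T₀ ++ T₁`) and `K ∨ (p ↔ χ)` (`(p, χ) ∈ E`), generic in an operation kit `k`:

0. unweaken the constraints of copy `0` (the gadgets of both copies are congruent, `o₁` is a
   line of `T₁`); literals of the zero gates;
1. congruences across the copies: `res Y₀ ≡ res Y₁`, `res A₀ ≡ res A₁`, `res Z₀ ≡ res B₀`, hence
   `res B₀ ≡ res Y₁` by the certificate of copy `0`;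
2. domain certificates: the global words, `res Y₁ < n`, and by `domAll` the nodes of
   `A₁, Z₁, Hs_j, Ht_j`;
3. the exponent swap `res A₂ ≡ res A₄` (`EFChainLaws.lean`), the congruences `A₂ ≅ C₀ ≅ X₀`,
   `A₄ ≅ X₁`, and the clash of the parity literals of `(res X₀)₀ ≡ (res X₁)₀`.

## Sources

* J. Krajíček, P. Pudlák, *Some consequences of cryptographical conjectures for `S¹₂` and `EF`*,
  Inform. and Comput. 140 (1998), Thm. 1, Cor. 10.
* S. A. Cook, R. A. Reckhow, *The relative efficiency of propositional proof systems*,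
  J. Symbolic Logic 44 (1979), §2.
-/

namespace Literature.Computability.MetaComplexity

open _root_.Computability Complexity Complexity.PropForm FregeSystem Netlist ModAdd

namespace RSA

variable {W : ℕ} {k : ModAdd.OpKit W} {m P₀ P₁ Eb : ℕ} {G : FregeSystem} {K : PropForm ℕ} {Γ : Set (PropForm ℕ)}

/-! ### Single inferences -/

/-- Transport of truth along a bit equality. [cite: CookReckhow1979, §2] -/
theorem yTrue (hG : ∀ r ∈ Logic.rules, r ∈ G.rules) {a b : ℕ} (ha : ctx K (var a) ∈ Γ) (he : ctx K (eqv a b) ∈ Γ) :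
    G.Yields Γ {ctx K (var b)} (K.size + 10) :=
  (Yields.single (Logic.infer hG 7 (by decide) (FregeSystem.sub [K, var a, var b]) (θ := ctx K (var b)) rfl
    (FregeSystem.prems_cons ha (FregeSystem.prems_cons he FregeSystem.prems_nil)))).mono_size (by simp [ctx, size])

/-- A gate defined as `⊥` is false. [cite: CookReckhow1979, §2] -/
theorem yCstF (hG : ∀ r ∈ Logic.rules, r ∈ G.rules) {z : ℕ} (h : ctx K (biimp (var z) (const false)) ∈ Γ) : G.Yields Γ {ctx K (neg (var z))} (K.size + 10) :=
  (Yields.single (Logic.infer hG 11 (by decide) (FregeSystem.sub [K, var z]) (θ := ctx K (neg (var z))) rfl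
    (FregeSystem.prems_cons h FregeSystem.prems_nil))).mono_size (by simp [ctx, size])

/-- Two false bits are equal. [cite: CookReckhow1979, §2] -/
theorem yEqvFF (hG : ∀ r ∈ Logic.rules, r ∈ G.rules) {a b : ℕ} (ha : ctx K (neg (var a)) ∈ Γ) (hb : ctx K (neg (var b)) ∈ Γ) :
    G.Yields Γ {ctx K (eqv a b)} (K.size + 10) :=
  (Yields.single (Logic.infer hG 10 (by decide) (FregeSystem.sub [K, var a, var b]) (θ := ctx K (eqv a b)) rfl
    (FregeSystem.prems_cons ha (FregeSystem.prems_cons hb FregeSystem.prems_nil)))).mono_size (by simp [ctx, eqv, size, FregeSystem.size_biimp])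

/-- The clash. [cite: CookReckhow1979, §2] -/
theorem yClash (hG : ∀ r ∈ Logic.rules, r ∈ G.rules) {a b : ℕ} (ha : ctx K (var a) ∈ Γ) (hb : ctx K (neg (var b)) ∈ Γ) (he : ctx K (eqv a b) ∈ Γ) :
    G.Yields Γ {ctx K (const false)} (K.size + 10) :=
  (Yields.single (Logic.infer hG 18 (by decide) (FregeSystem.sub [K, var a, var b]) (θ := ctx K (const false)) rfl
    (FregeSystem.prems_cons ha (FregeSystem.prems_cons hb (FregeSystem.prems_cons he FregeSystem.prems_nil))))).mono_size (by simp [ctx, size])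

/-! ### Congruence tools -/

/-- Bit equalities of three-operand inputs from the equalities of the words. [folklore] -/
theorem eqv_inp3 {x y n x' y' n' : ℕ → ℕ} (hx : Holds K Γ (eqW x x' W)) (hy : Holds K Γ (eqW y y' W)) (hn : Holds K Γ (eqW n n' W)) :
    ∀ q < 3 * W, ctx K (eqv (inp3 (W := W) x y n q) (inp3 (W := W) x' y' n' q)) ∈ Γ := by
  intro q hq
  unfold inp3; split_ifs with h1 h2
  · exact holds_eqW_iff.1 hx q h1
  · exact holds_eqW_iff.1 hy (q - W) (by omega)
  · exact holds_eqW_iff.1 hn (q - 2 * W) (by omega)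

/-- **Congruence of two occurrences of a template**: bitwise equal inputs give bitwise equal gates.
[cite: CookReckhow1979, §2] -/
theorem congr (hG : CRulesOK G) {t : Template} {nIn : ℕ} (hwf : t.WF nIn) {o o' : Occ} (ho : o.Avail t nIn K Γ) (ho' : o'.Avail t nIn K Γ)
    (hin : ∀ i < nIn, ctx K (eqv (o.inp i) (o'.inp i)) ∈ Γ) :
    ∃ Δ : Set (PropForm ℕ), G.Yields Γ Δ (t.length * (K.size + 10)) ∧ Holds K (Γ ∪ Δ) (eqW (fun g => o.base + g) (fun g => o'.base + g) t.length) :=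
  ⟨_, occLeib hG.netlist hwf o o' ho ho' hin, holds_eqW_iff.2 fun _ hg => Or.inr (wire_mem_occLeib hg)⟩

/-- Results of congruent operation occurrences are equal. [folklore] -/
theorem holds_res {o o' : Occ} {Γ' : Set (PropForm ℕ)} (h : Holds K Γ' (eqW (fun g => o.base + g) (fun g => o'.base + g) k.T.length)) :
    Holds K Γ' (eqW (k.res o) (k.res o') W) :=
  holds_eqW_iff.2 fun i hi => holds_eqW_iff.1 h (k.resOff i) (k.resOff_lt i hi)

/-- Results of congruent chain occurrences are equal. [folklore] -/
theorem holds_t {o o' : Occ} {Γ' : Set (PropForm ℕ)} (h : Holds K Γ' (eqW (fun g => o.base + g) (fun g => o'.base + g) k.chainT.length)) :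
    Holds K Γ' (eqW (k.t o W) (k.t o' W) W) :=
  holds_eqW_iff.2 fun i hi => by rw [k.t_eq, k.t_eq]; exact holds_eqW_iff.1 h (k.tOff W i) (k.tOff_lt le_rfl hi)

/-- Padded words agreeing on the atoms and with equal padding are equal. [folklore] -/
theorem holds_eqW_pad {a : ℕ → ℕ} {z z' : ℕ} (hatoms : ∀ i < m, ctx K (eqv (a i) (a i)) ∈ Γ) (hz : ctx K (eqv z z') ∈ Γ) :
    Holds K Γ (eqW (fun i => if i < m then a i else z) (fun i => if i < m then a i else z') W) :=
  holds_eqW_iff.2 fun i _ => by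
    by_cases h : i < m
    · simp only [if_pos h]; exact hatoms i h
    · simp only [if_neg h]; exact hz

/-! ### Phase 0: unweakening copy `0`, literals of the zero gates -/

/-- The facts produced by phase 0. [folklore] -/
structure Facts0 (k : ModAdd.OpKit W) (m P₀ P₁ : ℕ) (K : PropForm ℕ) (Γ' : Set (PropForm ℕ)) : Prop where
  /-- the definitions of the computing occurrences of copy `0` -/
  defs0 : ∀ e ∈ compDefs k m P₀, ctx K (biimp (var e.1) e.2) ∈ Γ'
  /-- the certificate of copy `0` -/
  cert0 : Holds K Γ' (certZ k m P₀)
  /-- the parity literal of copy `0` -/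
  par0 : ctx K (neg (var (k.t (Xo k m P₀) W 0))) ∈ Γ'
  /-- the zero gates are false -/
  z0 : ctx K (neg (var (zv m P₀))) ∈ Γ'
  /-- the zero gates are false -/
  z1 : ctx K (neg (var (zv m P₁))) ∈ Γ'
  /-- the zero gates are equal -/
  zz : ctx K (eqv (zv m P₁) (zv m P₀)) ∈ Γ'
  /-- the gadget outputs are equal -/
  oo : ctx K (eqv (ov m P₁) (ov m P₀)) ∈ Γ'

/-- Monotonicity of the facts. [folklore] -/
theorem Facts0.mono {Γ' Γ'' : Set (PropForm ℕ)} (h : Facts0 k m P₀ P₁ K Γ') (hΓ : Γ' ⊆ Γ'') : Facts0 k m P₀ P₁ K Γ'' :=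
  ⟨fun e he => hΓ (h.defs0 e he), h.cert0.mono hΓ, hΓ h.par0, hΓ h.z0, hΓ h.z1, hΓ h.zz, hΓ h.oo⟩

/-- Size of phase 0. [folklore] -/
def size0 (k : ModAdd.OpKit W) (m Ks : ℕ) : ℕ :=
  m * (Ks + 10) + (m - 1 + 1) * (Ks + 10) + (Ks + 10) + ((compDefs k m 0).length + W + 1) * (Ks + 57 + 1) + 3 * (Ks + 10)

/-- The length of the computing definitions does not depend on the base. [folklore] -/
@[simp] theorem length_compDefs (P : ℕ) : (compDefs k m P).length = 1 + k.T.length + 3 * k.chainT.length := by simp [compDefs]; ring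

/-- Sizes of the bodies in the computing definitions. [folklore] -/
theorem size_of_mem_compDefs {P : ℕ} {e : ℕ × PropForm ℕ} (he : e ∈ compDefs k m P) : e.2.size ≤ 25 := by
  simp only [compDefs, List.mem_append] at he
  rcases he with (((he | he) | he) | he) | he <;> exact Occ.size_of_mem_edefs he

/-- The zero-gate definition of a copy. [folklore] -/
theorem zdef_mem_compDefs (P : ℕ) : (zv m P, const false) ∈ compDefs k m P := by
  simp only [compDefs, List.mem_append]
  exact Or.inl (Or.inl (Or.inl (Or.inl (((ZO m P).inst 0).wire_body_mem_defs (constRow (fun _ => false) 1) (k := 0) (by simp)))))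

/-- **Phase 0.** [cite: KrajicekPudlak1998, Thm. 1] -/
theorem phase0 (hG : CRulesOK G) (hR : ∀ r ∈ rules, r ∈ G.rules) (hT0 : ∀ c ∈ T0 k m P₀, ctx K c ∈ Γ) (hT1 : ∀ c ∈ T1 k m P₁, ctx K c ∈ Γ) :
    ∃ Δ : Set (PropForm ℕ), G.Yields Γ Δ (size0 k m K.size) ∧ Facts0 k m P₀ P₁ K (Γ ∪ Δ) := by
  have hΓ : ∀ {X : Set (PropForm ℕ)}, Γ ⊆ Γ ∪ X := fun {X} => Set.subset_union_left
  -- the gadgets are available and congruent, so `o₀` holds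
  have hOR0 : (ORo m P₀).Avail (orT m) m K Γ := Occ.avail_of_forall_mem fun e he => hT0 _ (List.mem_append_left _ (List.mem_map_of_mem he))
  have hOR1 : (ORo m P₁).Avail (orT m) m K Γ := Occ.avail_of_forall_mem fun e he =>
    hT1 _ (List.mem_append_left _ (List.mem_append_left _ (List.mem_map_of_mem (List.mem_append_left _ (List.mem_append_left _ he)))))
  have b1 := Yields.eqW_refl hG.adder K (fun i => i) m (Γ := Γ)
  set A1 := ctxSet K (eqW (fun i => i) (fun i => i) m) with hA1
  obtain ⟨D2, b2, h2⟩ := congr hG (wf_orT m) (hOR1.mono (hΓ (X := A1))) (hOR0.mono hΓ) fun i hi => Or.inr (mem_ctxSet (mem_eqW hi))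
  rw [Set.union_assoc] at h2
  set A2 := A1 ∪ D2 with hA2
  have hoo : ctx K (eqv (ov m P₁) (ov m P₀)) ∈ Γ ∪ A2 := holds_eqW_iff.1 h2 (m - 1) (by simp)
  have ho1 : ctx K (var (ov m P₁)) ∈ Γ := hT1 _ (by simp [T1])
  have b3 := yTrue hG.logic (hΓ ho1) hoo
  set A3 : Set (PropForm ℕ) := A2 ∪ {ctx K (var (ov m P₀))} with hA3
  -- unweaken copy `0`
  set Ls := extAxioms (compDefs k m P₀) ++ certZ k m P₀ ++ [neg (var (k.t (Xo k m P₀) W 0))] with hLs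
  have hLsT : ∀ c ∈ Ls, ctx K (disj c (neg (var (ov m P₀)))) ∈ Γ := fun c hc => hT0 _ (List.mem_append_right _ (List.mem_map_of_mem hc))
  have hLsz : ∀ c ∈ Ls, c.size ≤ 57 := by
    intro c hc
    simp only [hLs, List.mem_append, List.mem_singleton] at hc
    rcases hc with (hc | hc) | rfl
    · obtain ⟨e, he, rfl⟩ := List.mem_map.1 hc
      have := size_of_mem_compDefs he
      rw [FregeSystem.size_biimp]; simp [size]; omega
    · obtain ⟨i, -, rfl⟩ := List.mem_map.1 hc
      rw [size_eqv]; omega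
    · simp [size]
  have b4 := unweaken hR (K := K) (Γ := Γ ∪ A3) (fun c hc => hΓ (hLsT c hc)) (Or.inr (Or.inr rfl)) hLsz
  set A4 := A3 ∪ ctxSet K Ls with hA4
  have hLen : Ls.length = (compDefs k m 0).length + W + 1 := by
    simp only [hLs, List.length_append, certZ, eqW, extAxioms, List.length_map, List.length_range, List.length_singleton, length_compDefs]
  rw [hLen] at b4
  -- literals of the zero gates
  have hz0d : ctx K (biimp (var (zv m P₀)) (const false)) ∈ Γ ∪ A4 :=
    Or.inr (Or.inr (mem_ctxSet (List.mem_append_left _ (List.mem_append_left _ (List.mem_map_of_mem (zdef_mem_compDefs (k := k) P₀))))))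
  have hz1d : ctx K (biimp (var (zv m P₁)) (const false)) ∈ Γ := hT1 _ (List.mem_append_left _ (List.mem_append_left _
    (List.mem_map_of_mem (List.mem_append_left _ (List.mem_append_right _ (zdef_mem_compDefs (k := k) P₁))))))
  have b5 := (yCstF hG.logic hz0d).union (yCstF hG.logic (hΓ hz1d))
  set A5 : Set (PropForm ℕ) := A4 ∪ ({ctx K (neg (var (zv m P₀)))} ∪ {ctx K (neg (var (zv m P₁)))}) with hA5
  have b6 := yEqvFF hG.logic (K := K) (Γ := Γ ∪ A5) (a := zv m P₁) (b := zv m P₀) (Or.inr (Or.inr (Or.inr rfl))) (Or.inr (Or.inr (Or.inl rfl)))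
  have h := ((((b1.trans b2).trans b3).trans b4).trans b5).trans b6
  refine ⟨_, h.mono_size ?_, ⟨fun e he => ?_, holds_ctxSet fun θ ⟨c, hc, hθ⟩ => ?_, ?_, ?_, ?_, ?_, ?_⟩⟩
  · simp only [size0, length_compDefs, length_orT]; nlinarith [Nat.zero_le K.size, Nat.zero_le m]
  · exact Or.inr (Or.inl (Or.inl (Or.inr (mem_ctxSet (List.mem_append_left _ (List.mem_append_left _ (List.mem_map_of_mem he)))))))
  · subst hθ; exact Or.inr (Or.inl (Or.inl (Or.inr (mem_ctxSet (List.mem_append_left _ (List.mem_append_right _ hc))))))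
  · exact Or.inr (Or.inl (Or.inl (Or.inr (mem_ctxSet (List.mem_append_right _ (List.mem_singleton_self _))))))
  · exact Or.inr (Or.inl (Or.inr (Or.inl rfl)))
  · exact Or.inr (Or.inl (Or.inr (Or.inr rfl)))
  · exact Or.inr (Or.inr rfl)
  · exact hoo.elim Or.inl fun h' => Or.inr (Or.inl (Or.inl (Or.inl (Or.inl h'))))

/-! ### Availability of the occurrences of the copies -/

section TAvail

variable {P : ℕ} {Γ' : Set (PropForm ℕ)} (h : ∀ e ∈ compDefs k m P, ctx K (biimp (var e.1) e.2) ∈ Γ')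
include h

/-- `Y`. [folklore] -/
theorem avYo : (Yo (W := W) m P).Avail k.T (3 * W) K Γ' := Occ.avail_of_forall_mem fun e he => h e (by simp [compDefs, he])
/-- `A`. [folklore] -/
theorem avAo : (Ao k m P).Avail k.chainT (3 * W) K Γ' := Occ.avail_of_forall_mem fun e he => h e (by simp [compDefs, he])
/-- `Z`. [folklore] -/
theorem avZo : (Zo k m P).Avail k.chainT (3 * W) K Γ' := Occ.avail_of_forall_mem fun e he => h e (by simp [compDefs, he])
/-- `X`. [folklore] -/
theorem avXo : (Xo k m P).Avail k.chainT (3 * W) K Γ' := Occ.avail_of_forall_mem fun e he => h e (by simp [compDefs, he])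

end TAvail

/-- The definitions of copy `1` from `T₁`. [folklore] -/
theorem defs1_of_T1 (hT1 : ∀ c ∈ T1 k m P₁, ctx K c ∈ Γ) : ∀ e ∈ compDefs k m P₁, ctx K (biimp (var e.1) e.2) ∈ Γ := fun _ he =>
  hT1 _ (List.mem_append_left _ (List.mem_append_left _ (List.mem_map_of_mem (List.mem_append_left _ (List.mem_append_right _ he)))))

/-- The comparator definitions of copy `1` from `T₁`. [folklore] -/
theorem cmps1_of_T1 (hT1 : ∀ c ∈ T1 k m P₁, ctx K c ∈ Γ) : ∀ e ∈ cmpDefs k m P₁, ctx K (biimp (var e.1) e.2) ∈ Γ := fun _ he =>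
  hT1 _ (List.mem_append_left _ (List.mem_append_left _ (List.mem_map_of_mem (List.mem_append_right _ he))))

/-- The certificate of copy `1`. [folklore] -/
theorem cert1_of_T1 (hT1 : ∀ c ∈ T1 k m P₁, ctx K c ∈ Γ) : Holds K Γ (certZ k m P₁) := fun _ hc => hT1 _ (List.mem_append_left _ (List.mem_append_right _ hc))

/-- The literals of `T₁`: parity, gadget, comparators. [folklore] -/
theorem lits1_of_T1 (hT1 : ∀ c ∈ T1 k m P₁, ctx K c ∈ Γ) :
    ctx K (var (k.t (Xo k m P₁) W 0)) ∈ Γ ∧ ctx K (var (ov m P₁)) ∈ Γ ∧ ctx K (neg (var ((VC0 k m P₁).ge W W))) ∈ Γ ∧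
      ctx K (neg (var ((VC1 k m P₁).ge W W))) ∈ Γ ∧ ctx K (neg (var ((VCY k m P₁).ge W W))) ∈ Γ :=
  ⟨hT1 _ (List.mem_append_right _ (by simp)), hT1 _ (List.mem_append_right _ (by simp)), hT1 _ (List.mem_append_right _ (by simp)),
    hT1 _ (List.mem_append_right _ (by simp)), hT1 _ (List.mem_append_right _ (by simp))⟩

/-- The comparator views of copy `1`. [folklore] -/
theorem views1_of_T1 (hT1 : ∀ c ∈ T1 k m P₁, ctx K c ∈ Γ) : (VC0 k m P₁).Avail K Γ W ∧ (VC1 k m P₁).Avail K Γ W ∧ (VCY k m P₁).Avail K Γ W := by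
  have h := cmps1_of_T1 hT1
  refine ⟨subView_avail (o := C0 k m P₁) (Occ.avail_of_forall_mem fun e he => h e (by simp [cmpDefs, he])) (fun i hi => by simp [C0, inp2, hi]) fun i hi => ?_,
    subView_avail (o := C1 k m P₁) (Occ.avail_of_forall_mem fun e he => h e (by simp [cmpDefs, he])) (fun i hi => by simp [C1, inp2, hi]) fun i hi => ?_,
    subView_avail (o := CY k m P₁) (Occ.avail_of_forall_mem fun e he => h e (by simp [cmpDefs, he])) (fun i hi => by simp [CY, inp2, hi]) fun i hi => ?_⟩ <;>
  · simp only [C0, C1, CY]; unfold inp2; rw [if_neg (by omega), Nat.add_sub_cancel_left]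

/-! ### Phase 1: congruences across the copies -/

/-- The facts produced by phase 1. [folklore] -/
structure Facts1 (k : ModAdd.OpKit W) (m P₀ P₁ Eb : ℕ) (K : PropForm ℕ) (Γ' : Set (PropForm ℕ)) : Prop where
  /-- `res Y₁ ≡ res Y₀` -/
  ry : Holds K Γ' (eqW (k.res (Yo (W := W) m P₁)) (k.res (Yo (W := W) m P₀)) W)
  /-- `n` words -/
  nn : Holds K Γ' (eqW (nw m P₁) (nw m P₀) W)
  /-- `u₀` word -/
  uu : Holds K Γ' (eqW (uw m P₀) (uw m P₀) W)
  /-- `res B₀ ≡ res Y₁` -/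
  by1 : Holds K Γ' (eqW (k.t (B0 k m P₀ P₁ Eb) W) (k.res (Yo (W := W) m P₁)) W)

/-- Monotonicity of the facts. [folklore] -/
theorem Facts1.mono {Γ' Γ'' : Set (PropForm ℕ)} (h : Facts1 k m P₀ P₁ Eb K Γ') (hΓ : Γ' ⊆ Γ'') : Facts1 k m P₀ P₁ Eb K Γ'' :=
  ⟨h.ry.mono hΓ, h.nn.mono hΓ, h.uu.mono hΓ, h.by1.mono hΓ⟩

/-- Size of phase 1. [folklore] -/
def size1 (k : ModAdd.OpKit W) (m Ks : ℕ) : ℕ := (3 * m + 4 * W + k.T.length + 2 * k.chainT.length) * (Ks + 10)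

/-- **Phase 1.** [cite: KrajicekPudlak1998, Thm. 1] -/
theorem phase1 (hG : CRulesOK G) (hT1 : ∀ c ∈ T1 k m P₁, ctx K c ∈ Γ) (hE : ∀ e ∈ E k m P₀ P₁ Eb, ctx K (biimp (var e.1) e.2) ∈ Γ)
    (f0 : Facts0 k m P₀ P₁ K Γ) : ∃ Δ : Set (PropForm ℕ), G.Yields Γ Δ (size1 k m K.size) ∧ Facts1 k m P₀ P₁ Eb K (Γ ∪ Δ) := by
  have hΓ : ∀ {X : Set (PropForm ℕ)}, Γ ⊆ Γ ∪ X := fun {X} => Set.subset_union_left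
  have d1 := defs1_of_T1 hT1
  -- reflexivity on the atoms and on `u₀`
  have b1 := (((Yields.eqW_refl hG.adder K (fun i => i) m (Γ := Γ)).union (Yields.eqW_refl hG.adder K (fun i => m + i) m)).union
    (Yields.eqW_refl hG.adder K (fun i => 2 * m + i) m)).union (Yields.eqW_refl hG.adder K (uw m P₀) W)
  set A1 := ctxSet K (eqW (fun i => i) (fun i => i) m) ∪ ctxSet K (eqW (fun i => m + i) (fun i => m + i) m) ∪
    ctxSet K (eqW (fun i => 2 * m + i) (fun i => 2 * m + i) m) ∪ ctxSet K (eqW (uw m P₀) (uw m P₀) W) with hA1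
  have hnn : Holds K (Γ ∪ A1) (eqW (nw m P₁) (nw m P₀) W) :=
    holds_eqW_pad (fun i hi => Or.inr (Or.inl (Or.inl (Or.inl (mem_ctxSet (mem_eqW hi)))))) (hΓ f0.zz)
  have hee : Holds K (Γ ∪ A1) (eqW (ew m P₁) (ew m P₀) W) :=
    holds_eqW_pad (fun i hi => Or.inr (Or.inl (Or.inl (Or.inr (mem_ctxSet (mem_eqW hi)))))) (hΓ f0.zz)
  have hyy : Holds K (Γ ∪ A1) (eqW (yw m P₁) (yw m P₀) W) :=
    holds_eqW_pad (fun i hi => Or.inr (Or.inl (Or.inr (mem_ctxSet (mem_eqW hi))))) (hΓ f0.zz)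
  have huu : Holds K (Γ ∪ A1) (eqW (uw m P₀) (uw m P₀) W) := holds_ctxSet fun θ hθ => Or.inr (Or.inr hθ)
  have hoo : Holds K (Γ ∪ A1) (eqW (onew m P₁) (onew m P₀) W) := holds_eqW_iff.2 fun i _ => by
    unfold onew; split_ifs
    · exact hΓ f0.oo
    · exact hΓ f0.zz
  -- `Y₁ ≅ Y₀`
  obtain ⟨D2, b2, h2⟩ := congr hG k.wf ((avYo d1).mono (hΓ (X := A1))) ((avYo f0.defs0).mono hΓ) (eqv_inp3 hoo hyy hnn)
  rw [Set.union_assoc] at h2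
  set A2 := A1 ∪ D2 with hA2
  have hry : Holds K (Γ ∪ A2) (eqW (k.res (Yo (W := W) m P₁)) (k.res (Yo (W := W) m P₀)) W) := holds_res h2
  -- `A₁ ≅ A₀`
  have hA12 : Γ ∪ A1 ⊆ Γ ∪ A2 := Set.union_subset_union_right _ Set.subset_union_left
  obtain ⟨D3, b3, h3⟩ := congr hG k.wf_chainT ((avAo d1).mono (hΓ (X := A2))) ((avAo f0.defs0).mono hΓ) (eqv_inp3 hry (hee.mono hA12) (hnn.mono hA12))
  rw [Set.union_assoc] at h3
  set A3 := A2 ∪ D3 with hA3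
  have hta : Holds K (Γ ∪ A3) (eqW (k.t (Ao k m P₁) W) (k.t (Ao k m P₀) W) W) := holds_t h3
  -- `B₀ ≅ Z₀`
  have hA13 : Γ ∪ A1 ⊆ Γ ∪ A3 := hA12.trans (Set.union_subset_union_right _ Set.subset_union_left)
  obtain ⟨D4, b4, h4⟩ := congr hG k.wf_chainT ((avB0 hE).mono (hΓ (X := A3))) ((avZo f0.defs0).mono hΓ) (eqv_inp3 hta (huu.mono hA13) (hnn.mono hA13))
  rw [Set.union_assoc] at h4
  set A4 := A3 ∪ D4 with hA4
  have htb : Holds K (Γ ∪ A4) (eqW (k.t (B0 k m P₀ P₁ Eb) W) (k.t (Zo k m P₀) W) W) := holds_t h4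
  -- `res B₀ ≡ res Z₀ ≡ res Y₀ ≡ res Y₁`
  have b5 := Yields.eqW_trans hG.logic htb ((f0.cert0.mono hΓ : Holds K (Γ ∪ A4) (certZ k m P₀)))
  set A5 := A4 ∪ ctxSet K (eqW (k.t (B0 k m P₀ P₁ Eb) W) (k.res (Yo (W := W) m P₀)) W) with hA5
  have hA25 : Γ ∪ A2 ⊆ Γ ∪ A5 := Set.union_subset_union_right _ (Set.subset_union_left.trans (Set.subset_union_left.trans Set.subset_union_left))
  have b6 := Yields.eqW_symm hG.logic (hry.mono hA25)
  set A6 := A5 ∪ ctxSet K (eqW (k.res (Yo (W := W) m P₀)) (k.res (Yo (W := W) m P₁)) W) with hA6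
  have b7 := Yields.eqW_trans hG.logic (K := K) (Γ := Γ ∪ A6) (a := k.t (B0 k m P₀ P₁ Eb) W) (b := k.res (Yo (W := W) m P₀)) (d := k.res (Yo (W := W) m P₁))
    (holds_ctxSet fun θ hθ => Or.inr (Or.inl (Or.inr hθ))) (holds_ctxSet fun θ hθ => Or.inr (Or.inr hθ))
  have h := (((((b1.trans b2).trans b3).trans b4).trans b5).trans b6).trans b7
  have hA1e : Γ ∪ A1 ⊆ Γ ∪ (A6 ∪ ctxSet K (eqW (k.t (B0 k m P₀ P₁ Eb) W) (k.res (Yo (W := W) m P₁)) W)) :=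
    hA13.trans (Set.union_subset_union_right _ (Set.subset_union_left.trans (Set.subset_union_left.trans (Set.subset_union_left.trans Set.subset_union_left))))
  refine ⟨_, h.mono_size ?_, ⟨hry.mono (hA25.trans (Set.union_subset_union_right _ (Set.subset_union_left.trans Set.subset_union_left))), hnn.mono hA1e, huu.mono hA1e,
    holds_ctxSet fun θ hθ => Or.inr (Or.inr hθ)⟩⟩
  simp only [size1]; nlinarith [Nat.zero_le K.size, Nat.zero_le m, Nat.zero_le W]

/-! ### Phase 2: domain certificates -/

/-- Domain facts of a chain occurrence: all `s_{j'}`, `t_{j'}` (`j' ≤ W`) are below `N`. [folklore] -/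
def DomFacts (k : ModAdd.OpKit W) (K : PropForm ℕ) (Γ' : Set (PropForm ℕ)) (N : ℕ → ℕ) (o : Occ) : Prop :=
  ∀ j' ≤ W, LtN W K Γ' (k.s o j') N ∧ LtN W K Γ' (k.t o j') N

/-- Monotonicity. [folklore] -/
theorem DomFacts.mono {Γ' Γ'' : Set (PropForm ℕ)} {N : ℕ → ℕ} {o : Occ} (h : DomFacts k K Γ' N o) (hΓ : Γ' ⊆ Γ'') : DomFacts k K Γ'' N o :=
  fun j' hj' => ⟨(h j' hj').1.mono hΓ, (h j' hj').2.mono hΓ⟩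

/-- **Domain facts of one chain by `domAll`**, for a chain reading the modulus word `nw₁` whose
first operand is certified. [folklore] -/
theorem domOne (hG : CRulesOK G) (hk : k.Rules G) {Γ' : Set (PropForm ℕ)} {o : Occ} {b : ℕ} (cv : k.ChainViews o K Γ') (ds : k.DomSupport o (Dview k b o) K Γ')
    (hon : ∀ i < W, o.inp (2 * W + i) = nw1 m P₁ i) (ha : LtN W K Γ' (ox o) (nw1 m P₁)) (hg : GlobW W k.m K Γ' (nw1 m P₁)) :
    ∃ Δ : Set (PropForm ℕ), G.Yields Γ' Δ ((W + 1) * k.domStep W K.size) ∧ DomFacts k K (Γ' ∪ Δ) (nw1 m P₁) o := by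
  have hon' : ∀ i < W, on W o i = nw1 m P₁ i := hon
  obtain ⟨Δ, hY, hs, hD, -⟩ := k.domAll hG hk cv ds (ha.congr (fun _ _ => rfl) hon') (hg.congr hon') W le_rfl
  refine ⟨Δ, hY, fun j' hj' => ⟨(hs j' hj').congr (fun _ _ => rfl) fun i hi => (hon i hi).symm, ?_⟩⟩
  have hL : LtN W K (Γ' ∪ Δ) (k.t o j') (fun i => o.inp (2 * W + i)) := ⟨_, (ds.hD j' hj').mono Set.subset_union_left, hD j' hj'⟩
  exact hL.congr (fun _ _ => rfl) fun i hi => (hon i hi).symm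

/-- The facts produced by phase 2. [folklore] -/
structure Facts2 (k : ModAdd.OpKit W) (m P₀ P₁ Eb : ℕ) (K : PropForm ℕ) (Γ' : Set (PropForm ℕ)) : Prop where
  /-- the global words -/
  hg : GlobW W k.m K Γ' (nw1 m P₁)
  /-- `Z₁` -/
  dZ : DomFacts k K Γ' (nw1 m P₁) (Z1 k m P₁)
  /-- `Hs_j` -/
  dHs : ∀ j ≤ W, DomFacts k K Γ' (nw1 m P₁) (Hs k m P₀ P₁ Eb j)
  /-- `Ht_j` -/
  dHt : ∀ j ≤ W, DomFacts k K Γ' (nw1 m P₁) (Ht k m P₀ P₁ Eb j)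

/-- Size of phase 2. [folklore] -/
def size2 (k : ModAdd.OpKit W) (Ks : ℕ) : ℕ := (2 * W + 5) * ((W + 1) * k.domStep W Ks)

/-- The family of supported chains, by induction. [folklore] -/
theorem domFamily (hG : CRulesOK G) (hk : k.Rules G) {Γ' : Set (PropForm ℕ)} (hE : ∀ e ∈ E k m P₀ P₁ Eb, ctx K (biimp (var e.1) e.2) ∈ Γ')
    (hg : GlobW W k.m K Γ' (nw1 m P₁)) (dZ : DomFacts k K Γ' (nw1 m P₁) (Z1 k m P₁)) :
    ∀ c ≤ 2 * W + 2, ∃ Δ : Set (PropForm ℕ), G.Yields Γ' Δ (c * ((W + 1) * k.domStep W K.size)) ∧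
      ∀ c', 1 ≤ c' → c' ≤ c → c' < 2 * W + 3 → DomFacts k K (Γ' ∪ Δ) (nw1 m P₁) (chn k m P₀ P₁ Eb c')
  | 0, _ => ⟨∅, Yields.of_subset G (Set.empty_subset _) _, fun c' h1 h2 _ => absurd h2 (by omega)⟩
  | c + 1, hc => by
    obtain ⟨Δ, hY, hF⟩ := domFamily hG hk hE hg dZ c (by omega)
    have hΓ : Γ' ⊆ Γ' ∪ Δ := Set.subset_union_left
    -- the chain `c + 1`: `Hs_c` (`c ≤ W`) or `Ht_{c-W-1}`
    have key : ∃ Δ' : Set (PropForm ℕ), G.Yields (Γ' ∪ Δ) Δ' ((W + 1) * k.domStep W K.size) ∧ DomFacts k K (Γ' ∪ Δ ∪ Δ') (nw1 m P₁) (chn k m P₀ P₁ Eb (c + 1)) := by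
      by_cases hcW : c ≤ W
      · have e : chn k m P₀ P₁ Eb (c + 1) = Hs k m P₀ P₁ Eb c := by unfold chn; rw [if_neg (by omega), if_pos (by omega), Nat.add_sub_cancel]
        rw [e]
        have ds := dsHs hE hcW
        exact domOne hG hk (k.chainAvail ((avHs hE hcW).mono hΓ)) (ds.mono hΓ) (fun i _ => by simp only [Hs]; rw [inp3_n])
          (((dZ c hcW).1.mono hΓ).congr (fun i hi => by simp [ModAdd.ox, Hs, inp3, hi]) fun _ _ => rfl) (hg.mono hΓ)
      · have e : chn k m P₀ P₁ Eb (c + 1) = Ht k m P₀ P₁ Eb (c - W - 1) := by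
          unfold chn; rw [if_neg (by omega), if_neg (by omega), show c + 1 - W - 2 = c - W - 1 by omega]
        rw [e]
        have hj : c - W - 1 ≤ W := by omega
        have ds := dsHt hE hj
        exact domOne hG hk (k.chainAvail ((avHt hE hj).mono hΓ)) (ds.mono hΓ) (fun i _ => by simp only [Ht]; rw [inp3_n])
          (((dZ _ hj).2.mono hΓ).congr (fun i hi => by simp [ModAdd.ox, Ht, inp3, hi]) fun _ _ => rfl) (hg.mono hΓ)
    obtain ⟨Δ', hY', hF'⟩ := key
    refine ⟨Δ ∪ Δ', by rw [Nat.succ_mul]; exact hY.trans hY', fun c' h1 h2 h3 => ?_⟩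
    have hF'' : DomFacts k K (Γ' ∪ (Δ ∪ Δ')) (nw1 m P₁) (chn k m P₀ P₁ Eb (c + 1)) := by rw [← Set.union_assoc]; exact hF'
    rcases Nat.lt_succ_iff_lt_or_eq.1 (Nat.lt_succ_iff.2 h2) with h2' | rfl
    · exact (hF c' h1 (Nat.lt_succ_iff.1 h2') h3).mono (Set.union_subset_union_right _ Set.subset_union_left)
    · exact hF''

/-- **Phase 2.** [cite: KrajicekPudlak1998, Thm. 1] -/
theorem phase2 (hG : CRulesOK G) (hk : k.Rules G) (hkm : m ≤ k.m) (hT1 : ∀ c ∈ T1 k m P₁, ctx K c ∈ Γ)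
    (hE : ∀ e ∈ E k m P₀ P₁ Eb, ctx K (biimp (var e.1) e.2) ∈ Γ) (f0 : Facts0 k m P₀ P₁ K Γ) :
    ∃ Δ : Set (PropForm ℕ), G.Yields Γ Δ (size2 k K.size) ∧ Facts2 k m P₀ P₁ Eb K (Γ ∪ Δ) := by
  have hΓ : ∀ {X : Set (PropForm ℕ)}, Γ ⊆ Γ ∪ X := fun {X} => Set.subset_union_left
  have d1 := defs1_of_T1 hT1
  obtain ⟨v0, v1, vy⟩ := views1_of_T1 hT1
  obtain ⟨-, lo, l0, l1, ly⟩ := lits1_of_T1 hT1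
  -- the global words
  have hg : GlobW W k.m K Γ (nw1 m P₁) := by
    refine ⟨⟨fun _ => zv m P₁, holds_litW_iff.2 fun i _ => f0.z1, ⟨_, v0, l0⟩⟩, ⟨onew m P₁, holds_litW_iff.2 fun i _ => ?_, ⟨_, v1, l1⟩⟩, fun i hi _ => ?_⟩
    · unfold onew; by_cases h0 : i = 0
      · rw [if_pos h0, h0]; exact lo
      · rw [if_neg h0, decide_eq_false h0]; exact f0.z1
    · simp only [nw1]; unfold nw; rw [if_neg (by omega)]; exact f0.z1
  -- `res Y₁ < n`, the chain `A₁`, so `res A₁ < n`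
  have hY : LtN W K Γ (k.res (Yo (W := W) m P₁)) (nw1 m P₁) := ⟨_, vy, ly⟩
  obtain ⟨D1, b1, fA⟩ := domOne hG hk (k.chainAvail (avAo d1)) (dsA1 hE) (fun i _ => by simp only [Ao]; rw [inp3_n])
    (hY.congr (fun i hi => by simp [ModAdd.ox, Ao, inp3, hi]) fun _ _ => rfl) hg
  -- the chain `Z₁`
  obtain ⟨D2, b2, fZ⟩ := domOne hG hk (k.chainAvail ((avZo d1).mono (hΓ (X := D1)))) ((dsZ1 hE).mono hΓ) (fun i _ => by simp only [Zo]; rw [inp3_n])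
    ((fA W le_rfl).2.congr (fun i hi => by simp [ModAdd.ox, Zo, inp3, hi]) fun _ _ => rfl) (hg.mono hΓ)
  rw [Set.union_assoc] at fZ
  set A2 := D1 ∪ D2 with hA2
  -- the family
  obtain ⟨D3, b3, fF⟩ := domFamily hG hk (fun e he => hΓ (X := A2) (hE e he)) (hg.mono hΓ) fZ (2 * W + 2) le_rfl
  rw [Set.union_assoc] at fF
  have h := (b1.trans b2).trans b3
  refine ⟨_, h.mono_size ?_, ⟨hg.mono hΓ, fZ.mono (Set.union_subset_union_right _ Set.subset_union_left), fun j hj => ?_, fun j hj => ?_⟩⟩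
  · simp only [size2]; nlinarith [Nat.zero_le ((W + 1) * k.domStep W K.size)]
  · have h := fF (j + 1) (by omega) (by omega) (by omega)
    have e : chn k m P₀ P₁ Eb (j + 1) = Hs k m P₀ P₁ Eb j := by unfold chn; rw [if_neg (by omega), if_pos (by omega), Nat.add_sub_cancel]
    rwa [e] at h
  · have h := fF (W + 2 + j) (by omega) (by omega) (by omega)
    have e : chn k m P₀ P₁ Eb (W + 2 + j) = Ht k m P₀ P₁ Eb j := by
      unfold chn; rw [if_neg (by omega), if_neg (by omega), show W + 2 + j - W - 2 = j by omega]
    rwa [e] at h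

/-! ### Phase 3: the swap and the clash -/

/-- Size of phase 3. [folklore] -/
def size3 (k : ModAdd.OpKit W) (Ks : ℕ) : ℕ :=
  k.swapBase W Ks + W * k.swapStep W Ks + (k.chainT.length + 5 * W) * (Ks + 10) + 3 * ((k.chainT.length + 2 * W) * (Ks + 10)) + 6 * (W * (Ks + 10)) + (Ks + 10)

/-- **Phase 3.** [cite: KrajicekPudlak1998, Thm. 1] -/
theorem phase3 (hG : CRulesOK G) (hk : k.Rules G) (hW : 0 < W) (hT1 : ∀ c ∈ T1 k m P₁, ctx K c ∈ Γ) (hE : ∀ e ∈ E k m P₀ P₁ Eb, ctx K (biimp (var e.1) e.2) ∈ Γ)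
    (f0 : Facts0 k m P₀ P₁ K Γ) (f1 : Facts1 k m P₀ P₁ Eb K Γ) (f2 : Facts2 k m P₀ P₁ Eb K Γ) :
    G.Yields Γ {ctx K (const false)} (size3 k K.size) := by
  have hΓ : ∀ {X : Set (PropForm ℕ)}, Γ ⊆ Γ ∪ X := fun {X} => Set.subset_union_left
  have d1 := defs1_of_T1 hT1
  obtain ⟨lx, -, -, -, -⟩ := lits1_of_T1 hT1
  have cvZ : k.ChainViews (Z1 k m P₁) K Γ := k.chainAvail (avZo d1)
  have hon : ∀ i < W, on W (Z1 k m P₁) i = nw1 m P₁ i := fun i _ => by simp only [ModAdd.on, Zo]; rw [inp3_n]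
  -- the swap
  have b1 := k.swap hG hk swapShape (swapAvail hE cvZ) (fun j _ => distShapeS j) (fun j hj => distAvailS hE cvZ hj) (fun j _ => distShapeP j)
    (fun j hj => distAvailP hE cvZ hj)
    (fun j hj j' hj' => ⟨((f2.dHs j hj) j' hj').1.congr (fun _ _ => rfl) hon, ((f2.dHs j hj) j' hj').2.congr (fun _ _ => rfl) hon⟩)
    (fun j hj j' hj' => ⟨((f2.dHt j hj) j' hj').1.congr (fun _ _ => rfl) hon, ((f2.dHt j hj) j' hj').2.congr (fun _ _ => rfl) hon⟩)
    (fun j hj => (f2.dZ j hj).2.congr (fun _ _ => rfl) hon) (k.chainAvail (avHt hE (Nat.zero_le W))) (dsHt hE (Nat.zero_le W)) (usHt0 hE) (f2.hg.congr hon)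
  set A1 := ctxSet K (eqW (k.t (A2o k m P₀ P₁ Eb) W) (k.t (A4o k m P₀ P₁ Eb) W) W) with hA1
  -- `A₂ ≅ C₀`
  have b2 := OpKit.chainLeib hG (K := K) (Γ := Γ ∪ A1) ((avA2 hE).mono hΓ) ((avC0 hE).mono hΓ) (x := k.t (Z1 k m P₁) W) (y := uw m P₀) (nw := nw1 m P₁)
    (x' := k.res (Yo (W := W) m P₁)) (y' := uw m P₀) (fun i hi => by simp [A2o, inp3, hi]) (fun i hi => by simp only [A2o]; rw [inp3_y _ _ _ _ hi])
    (fun i _ => by simp only [A2o]; rw [inp3_n]) (fun i hi => by simp [Cc0, inp3, hi]) (fun i hi => by simp only [Cc0]; rw [inp3_y _ _ _ _ hi])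
    (fun i _ => by simp only [Cc0]; rw [inp3_n]) ((cert1_of_T1 hT1).mono hΓ) (f1.uu.mono hΓ)
  set A2 := A1 ∪ ctxSet K (eqW (k.t (A2o k m P₀ P₁ Eb) W) (k.t (Cc0 k m P₀ P₁ Eb) W) W) with hA2
  -- `C₀ ≅ X₀`
  obtain ⟨D3, b3, h3⟩ := congr hG k.wf_chainT ((avC0 hE).mono (hΓ (X := A2))) ((avXo f0.defs0).mono hΓ)
    (eqv_inp3 (f1.ry.mono hΓ) (f1.uu.mono hΓ) (f1.nn.mono hΓ))
  rw [Set.union_assoc] at h3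
  set A3 := A2 ∪ D3 with hA3
  have hcx : Holds K (Γ ∪ A3) (eqW (k.t (Cc0 k m P₀ P₁ Eb) W) (k.t (Xo k m P₀) W) W) := holds_t h3
  -- `A₄ ≅ X₁`
  have b4 := Yields.eqW_refl hG.adder K (uw m P₁) W (Γ := Γ ∪ A3)
  set A4 := A3 ∪ ctxSet K (eqW (uw m P₁) (uw m P₁) W) with hA4
  have b5 := OpKit.chainLeib hG (K := K) (Γ := Γ ∪ A4) ((avA4 hE).mono hΓ) ((avXo d1).mono hΓ) (x := k.t (B0 k m P₀ P₁ Eb) W) (y := uw m P₁) (nw := nw1 m P₁)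
    (x' := k.res (Yo (W := W) m P₁)) (y' := uw m P₁) (fun i hi => by simp [A4o, inp3, hi]) (fun i hi => by simp only [A4o]; rw [inp3_y _ _ _ _ hi])
    (fun i _ => by simp only [A4o]; rw [inp3_n]) (fun i hi => by simp [Xo, inp3, hi]) (fun i hi => by simp only [Xo]; rw [inp3_y _ _ _ _ hi])
    (fun i _ => by simp only [Xo]; rw [inp3_n]) (f1.by1.mono hΓ) (holds_ctxSet fun θ hθ => Or.inr (Or.inr hθ))
  set A5 := A4 ∪ ctxSet K (eqW (k.t (A4o k m P₀ P₁ Eb) W) (k.t (Xo k m P₁) W) W) with hA5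
  -- `res X₁ ≡ res A₄ ≡ res A₂ ≡ res C₀ ≡ res X₀`
  have b6 := (Yields.eqW_symm hG.logic (K := K) (Γ := Γ ∪ A5) (a := k.t (A4o k m P₀ P₁ Eb) W) (b := k.t (Xo k m P₁) W) (W := W)
    (holds_ctxSet fun θ hθ => Or.inr (Or.inr hθ))).union
    (Yields.eqW_symm hG.logic (K := K) (Γ := Γ ∪ A5) (a := k.t (A2o k m P₀ P₁ Eb) W) (b := k.t (A4o k m P₀ P₁ Eb) W) (W := W)
    (holds_ctxSet fun θ hθ => Or.inr (Or.inl (Or.inl (Or.inl (Or.inl hθ))))))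
  set A6 := A5 ∪ (ctxSet K (eqW (k.t (Xo k m P₁) W) (k.t (A4o k m P₀ P₁ Eb) W) W) ∪ ctxSet K (eqW (k.t (A4o k m P₀ P₁ Eb) W) (k.t (A2o k m P₀ P₁ Eb) W) W)) with hA6
  have b7 := Yields.eqW_trans hG.logic (K := K) (Γ := Γ ∪ A6) (a := k.t (Xo k m P₁) W) (b := k.t (A4o k m P₀ P₁ Eb) W) (d := k.t (A2o k m P₀ P₁ Eb) W) (W := W)
    (holds_ctxSet fun θ hθ => Or.inr (Or.inr (Or.inl hθ))) (holds_ctxSet fun θ hθ => Or.inr (Or.inr (Or.inr hθ)))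
  set A7 := A6 ∪ ctxSet K (eqW (k.t (Xo k m P₁) W) (k.t (A2o k m P₀ P₁ Eb) W) W) with hA7
  have b8 := Yields.eqW_trans hG.logic (K := K) (Γ := Γ ∪ A7) (a := k.t (Xo k m P₁) W) (b := k.t (A2o k m P₀ P₁ Eb) W) (d := k.t (Cc0 k m P₀ P₁ Eb) W) (W := W)
    (holds_ctxSet fun θ hθ => Or.inr (Or.inr hθ)) (holds_ctxSet fun θ hθ => Or.inr (Or.inl (Or.inl (Or.inl (Or.inl (Or.inl (Or.inr hθ)))))))
  set A8 := A7 ∪ ctxSet K (eqW (k.t (Xo k m P₁) W) (k.t (Cc0 k m P₀ P₁ Eb) W) W) with hA8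
  have hA38 : Γ ∪ A3 ⊆ Γ ∪ A8 := Set.union_subset_union_right _
    (Set.subset_union_left.trans (Set.subset_union_left.trans (Set.subset_union_left.trans (Set.subset_union_left.trans Set.subset_union_left))))
  have b9 := Yields.eqW_trans hG.logic (K := K) (Γ := Γ ∪ A8) (a := k.t (Xo k m P₁) W) (b := k.t (Cc0 k m P₀ P₁ Eb) W) (d := k.t (Xo k m P₀) W) (W := W)
    (holds_ctxSet fun θ hθ => Or.inr (Or.inr hθ)) (hcx.mono hA38)
  set A9 := A8 ∪ ctxSet K (eqW (k.t (Xo k m P₁) W) (k.t (Xo k m P₀) W) W) with hA9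
  -- the clash at bit `0`
  have b10 := yClash hG.logic (K := K) (Γ := Γ ∪ A9) (hΓ lx) (hΓ f0.par0) (Or.inr (Or.inr (mem_ctxSet (mem_eqW hW))))
  have h := ((((((((b1.trans b2).trans b3).trans b4).trans b5).trans b6).trans b7).trans b8).trans b9).trans b10
  refine (h.mono_right fun θ hθ => Or.inr hθ).mono_size ?_
  simp only [size3]; nlinarith [Nat.zero_le K.size, Nat.zero_le W, Nat.zero_le k.chainT.length]

/-! ### The refutation -/

/-- **Size of the refutation.** [folklore] -/
def refSize (k : ModAdd.OpKit W) (m Ks : ℕ) : ℕ := size0 k m Ks + size1 k m Ks + size2 k Ks + size3 k Ks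

/-- **The refutation of `T₀ ∧ T₁`**: from the available lines of the scaffold, `K ∨ ⊥`.
[cite: KrajicekPudlak1998, Thm. 1, Cor. 10] -/
theorem refute (hG : CRulesOK G) (hk : k.Rules G) (hR : ∀ r ∈ rules, r ∈ G.rules) (hW : 0 < W) (hkm : m ≤ k.m)
    (hT0 : ∀ c ∈ T0 k m P₀, ctx K c ∈ Γ) (hT1 : ∀ c ∈ T1 k m P₁, ctx K c ∈ Γ) (hE : ∀ e ∈ E k m P₀ P₁ Eb, ctx K (biimp (var e.1) e.2) ∈ Γ) :
    G.Yields Γ {ctx K (const false)} (refSize k m K.size) := by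
  obtain ⟨D0, b0, f0⟩ := phase0 hG hR hT0 hT1
  have hΓ0 : Γ ⊆ Γ ∪ D0 := Set.subset_union_left
  obtain ⟨D1, b1, f1⟩ := phase1 hG (fun c hc => hΓ0 (hT1 c hc)) (fun e he => hΓ0 (hE e he)) f0
  have hΓ1 : Γ ⊆ Γ ∪ D0 ∪ D1 := hΓ0.trans Set.subset_union_left
  obtain ⟨D2, b2, f2⟩ := phase2 hG hk hkm (fun c hc => hΓ1 (hT1 c hc)) (fun e he => hΓ1 (hE e he)) (f0.mono Set.subset_union_left)
  have hΓ2 : Γ ⊆ Γ ∪ D0 ∪ D1 ∪ D2 := hΓ1.trans Set.subset_union_left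
  have b3 := phase3 hG hk hW (fun c hc => hΓ2 (hT1 c hc)) (fun e he => hΓ2 (hE e he)) ((f0.mono Set.subset_union_left).mono Set.subset_union_left)
    (f1.mono Set.subset_union_left) f2
  have b3' : G.Yields (Γ ∪ (D0 ∪ D1 ∪ D2)) {ctx K (const false)} (size3 k K.size) := by rw [Set.union_assoc]; rwa [Set.union_assoc, Set.union_assoc] at b3
  rw [Set.union_assoc] at b2
  have h := ((b0.trans b1).trans b2).trans b3'
  exact (h.mono_right fun θ hθ => Or.inr hθ).mono_size le_rfl

end RSA

end Literature.Computability.MetaComplexity
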